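import Literature.NumberTheory.Sieve.SmoothArcClassesEstimate
import Literature.NumberTheory.Sieve.SmoothArcClassesMajorant
import HarnessLib

/-!
# Class-restricted smooth arc sums: the pointwise estimate with the cancelling majorant

Topic `Literature/NumberTheory/Sieve`; a PROVED file, the pointwise form of
`SmoothArcClassesEstimate.classArcSum_estimate` ([Harper2016, §2.2, §5], [MontgomeryVaughanActa1975, §5–6]).
Notation of `SmoothArcClasses` / `SmoothArcClassesMajorant`: `L = lcm(k, m)`, `g_t = (t, L)`, `X = x/e`,
`α = α(x, y)`, `𝓜 = x^α ζ(α,y)/√(2πφ₂(α,y))`, `C_g(h) = classGcdSum m r k h g`.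

Two features of `classArcSum_estimate` are improved here.

* The principal part `φ(L/g_t)⁻¹ U(X/g_t, L/g_t)` of the fibre `t` and its main term depend on `t` only
  through `g_t`, so the principal-part errors are summed over the fibres with a common gcd `g` WITH their
  phases `e(ht/k)` (`sum_class_sub_eq`), and the error is majorised by the cancelling
  `classLocalHc α m r k h = ∑_{g ∣ L} ‖C_g(h)‖ g^{−α} τ(L/g)/φ(L/g)` instead of `classLocalH`
  (`norm_sum_class_sub_le`);
* the saddle-point input (hW) is taken AT the given `x`, with a free precision `η` and for the scalings
  `e' ≤ E` only, so the estimate is pointwise in `x` (`classArcSum_estimate_pointwise_of_mul_le`, which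
  needs `e · L ≤ E` since the scales met are `x/(e g d)` with `g d ∣ L`; `classArcSum_estimate_pointwise`
  is the same statement under `e · L² ≤ E`).

The result: for `x ≥ 0`, `ε₀ > 0`, `C_F ≥ 0`, `1 ≤ e`, `y`-friable `k, m ≥ 1`, ANY class `r` and numerator `h`,

`‖classArcSum (x/e) y m r k h λ − classLocalFactor α m r k h · e^{−α}𝓜 Ŵ_λ(α)‖`
`≤ e^{−α} (η𝓜/(1+|λ|)) · classLocalHc α m r k h + L · C_F (1+|λ|)³ (x/e)^{1/2+ε₀} L^{ε₀}`,

given (hW) `‖S_w(λ; x/e') − e'^{−α}𝓜Ŵ_λ(α)‖ ≤ e'^{−α} η𝓜/(1+|λ|)` for `1 ≤ e' ≤ E` and (hF) the character-sum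
currency `‖∑_{n ∈ S(X,y)} χ(n) W_λ(n/X)‖ ≤ C_F (1+|λ|)³ X^{1/2+ε₀} q^{ε₀}` (`X ≥ 1`, `χ ≠ χ₀ (mod q)`).
The fibre lemmas (`principal_fiber_bound`, `nonprincipal_fiber_bound`, `charSum_bound_subscale`) are those of
`SmoothArcClassesEstimate`; `charSum_bound_subscale_of_nonneg` relaxes `C > 0` to `C ≥ 0` by continuity.

## References

* A. J. Harper, Compositio Math. 152 (2016), §2.2, §5 [Harper2016].
* H. L. Montgomery, R. C. Vaughan, Acta Arith. 27 (1975), §5–6 [MontgomeryVaughanActa1975].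
-/

noncomputable section

open Finset Real Complex
open scoped ArithmeticFunction.Moebius FourierTransform

namespace Literature.NumberTheory.Sieve

namespace SmoothArcs

open MontgomeryVaughan1975 TwistedWeight

/-! ### The non-principal part of one fibre -/

/-- `charSum_bound_subscale` under the weaker sign condition `0 ≤ C` (the bound is continuous in `C` and holds
for every `C' > C`). [folklore] -/
theorem charSum_bound_subscale_of_nonneg {C ε₀ : ℝ} (hC : 0 ≤ C) (hε₀ : 0 < ε₀)
    (hF : ∀ (q : ℕ) (χ : DirichletCharacter ℂ q), q ≠ 0 → χ ≠ 1 → ∀ (y : ℕ) (X lam : ℝ), 1 ≤ X →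
      ‖∑ n ∈ Nat.smoothNumbersUpTo ⌊X⌋₊ (y + 1), χ (n : ZMod q) * twistWeight lam (n / X)‖ ≤
        C * (1 + |lam|) ^ 3 * X ^ (1 / 2 + ε₀) * (q : ℝ) ^ ε₀)
    {X : ℝ} (hX : 0 ≤ X) {g L L' : ℕ} (hg : 0 < g) (hL' : L' ≠ 0) (hL'L : L' ≤ L) (y : ℕ) (lam : ℝ)
    (ψ : DirichletCharacter ℂ L') (hψ : ψ ≠ 1) :
    ‖∑ n ∈ Nat.smoothNumbersUpTo ⌊X / g⌋₊ (y + 1), ψ (n : ZMod L') * twistWeight lam (n / (X / g))‖ ≤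
      C * (1 + |lam|) ^ 3 * X ^ (1 / 2 + ε₀) * (L : ℝ) ^ ε₀ := by
  have key : ∀ C' : ℝ, C < C' →
      ‖∑ n ∈ Nat.smoothNumbersUpTo ⌊X / g⌋₊ (y + 1), ψ (n : ZMod L') * twistWeight lam (n / (X / g))‖ ≤
        C' * (1 + |lam|) ^ 3 * X ^ (1 / 2 + ε₀) * (L : ℝ) ^ ε₀ := by
    intro C' hC'
    refine charSum_bound_subscale (hC.trans_lt hC') hε₀ (fun q χ hq hχ y' X' lam' hX' => ?_) hX hg hL' hL'L y lam ψ hψ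
    have hX'0 : 0 ≤ X' := zero_le_one.trans hX'
    exact (hF q χ hq hχ y' X' lam' hX').trans (mul_le_mul_of_nonneg_right (mul_le_mul_of_nonneg_right
      (mul_le_mul_of_nonneg_right hC'.le (by positivity)) (Real.rpow_nonneg hX'0 _)) (Real.rpow_nonneg (Nat.cast_nonneg q) _))
  refine ge_of_tendsto (x := nhdsWithin C (Set.Ioi C)) ?_ (eventually_nhdsWithin_of_forall key)
  exact ((((continuous_id.mul continuous_const).mul continuous_const).mul continuous_const).tendsto C).mono_left
    nhdsWithin_le_nhds

/-- **One fibre minus its principal part.** For `t < L`, `L ∈ S(y)`, `g = (t, L)`, `L' = L/g`: if every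
non-principal character sum on every sub-scale `X/g'` (`g' ≥ 1`) to every modulus `L'' ≤ L` is at most `Bd ≥ 0`,
then `‖∑_{n ∈ S(X,y), n % L = t} W_λ(n/X) − φ(L')⁻¹ U(X/g, L')‖ ≤ Bd` (the difference is the contribution of the
non-principal characters mod `L'`, `classFiber_eq`). [cite: MontgomeryVaughanActa1975, §6 (6.1)] -/
theorem fiber_sub_principal_bound {X : ℝ} (hX : 0 ≤ X) {y L t : ℕ} (hL : L ≠ 0) (ht : t < L)
    (hLS : L ∈ Nat.smoothNumbers (y + 1)) (lam : ℝ) {Bd : ℝ} (hBd : 0 ≤ Bd)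
    (hF : ∀ (g' L'' : ℕ) [NeZero L''], 0 < g' → L'' ≤ L → ∀ ψ : DirichletCharacter ℂ L'', ψ ≠ 1 →
      ‖∑ n ∈ Nat.smoothNumbersUpTo ⌊X / g'⌋₊ (y + 1), ψ (n : ZMod L'') * twistWeight lam (n / (X / g'))‖ ≤ Bd) :
    ‖(∑ n ∈ (Nat.smoothNumbersUpTo ⌊X⌋₊ (y + 1)).filter (fun n => n % L = t), twistWeight lam (n / X)) -
        (((L / Nat.gcd t L).totient : ℂ))⁻¹ * coprimeTwistSum (X / Nat.gcd t L) y (L / Nat.gcd t L) lam‖ ≤ Bd := by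
  rw [sum_filter_mod_eq hX hL ht hLS lam]
  set g : ℕ := Nat.gcd t L with hg
  have hg0 : 0 < g := Nat.gcd_pos_of_pos_right t (Nat.pos_of_ne_zero hL)
  have hgL : g ∣ L := Nat.gcd_dvd_right t L
  have hL'0 : L / g ≠ 0 := (Nat.div_ne_zero_iff_of_dvd hgL).mpr ⟨hL, hg0.ne'⟩
  haveI : NeZero (L / g) := ⟨hL'0⟩
  have hcop : (t / g).Coprime (L / g) := Nat.coprime_div_gcd_div_gcd hg0
  rw [classFiber_eq (X / g) y hcop lam, add_sub_cancel_left]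
  exact nonprincipal_fiber_bound (X / g) y (((t / g : ℕ) : ZMod (L / g)))⁻¹ lam hBd
    (fun ψ hψ => hF g (L / g) hg0 (Nat.div_le_self L g) ψ hψ)

/-! ### Regrouping the principal parts by the gcd -/

/-- **Regrouping.** For any fibre values `V(t)`, principal parts `P` and main terms `M`, the latter two depending
on the class `t` only through `g_t = (t, L)`:
`∑_t e(ht/k) V(t) − ∑_t e(ht/k) M(g_t) = ∑_{g ∣ L} C_g(h) (P(g) − M(g)) + ∑_t e(ht/k) (V(t) − P(g_t))`
(`sum_class_mul_apply_gcd_eq_sum_divisors`). [folklore] -/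
theorem sum_class_sub_eq (m r k : ℕ) (h : ℤ) (V P M : ℕ → ℂ) :
    ∑ t ∈ (Finset.range (Nat.lcm k m)).filter (fun t => t ≡ r [MOD m]), (𝐞 ((h * t : ℝ) / k) : ℂ) * V t -
        ∑ t ∈ (Finset.range (Nat.lcm k m)).filter (fun t => t ≡ r [MOD m]),
          (𝐞 ((h * t : ℝ) / k) : ℂ) * M (Nat.gcd t (Nat.lcm k m)) =
      ∑ g ∈ (Nat.lcm k m).divisors, classGcdSum m r k h g * (P g - M g) +
        ∑ t ∈ (Finset.range (Nat.lcm k m)).filter (fun t => t ≡ r [MOD m]),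
          (𝐞 ((h * t : ℝ) / k) : ℂ) * (V t - P (Nat.gcd t (Nat.lcm k m))) := by
  rw [← sum_class_mul_apply_gcd_eq_sum_divisors m r k h (fun g => P g - M g), ← Finset.sum_sub_distrib,
    ← Finset.sum_add_distrib]
  exact Finset.sum_congr rfl fun t _ => by ring

/-- **Assembly of the two errors.** If `‖P(g) − M(g)‖ ≤ g^{−α} τ(L/g)/φ(L/g) · E` for `g ∣ L` and
`‖V(t) − P(g_t)‖ ≤ Bd` (`Bd ≥ 0`) for every class `t ≡ r (m)` mod `L`, then
`‖∑_t e(ht/k) V(t) − ∑_t e(ht/k) M(g_t)‖ ≤ E · classLocalHc α m r k h + L · Bd`. [cite: Harper2016, §2.2, §5] -/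
theorem norm_sum_class_sub_le {m r k : ℕ} (h : ℤ) (α E : ℝ) {Bd : ℝ} (hBd : 0 ≤ Bd) (V P M : ℕ → ℂ)
    (hP : ∀ g ∈ (Nat.lcm k m).divisors,
      ‖P g - M g‖ ≤ (g : ℝ) ^ (-α) * ((Nat.lcm k m / g).divisors.card : ℝ) / ((Nat.lcm k m / g).totient : ℝ) * E)
    (hN : ∀ t ∈ (Finset.range (Nat.lcm k m)).filter (fun t => t ≡ r [MOD m]),
      ‖V t - P (Nat.gcd t (Nat.lcm k m))‖ ≤ Bd) :
    ‖∑ t ∈ (Finset.range (Nat.lcm k m)).filter (fun t => t ≡ r [MOD m]), (𝐞 ((h * t : ℝ) / k) : ℂ) * V t -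
        ∑ t ∈ (Finset.range (Nat.lcm k m)).filter (fun t => t ≡ r [MOD m]),
          (𝐞 ((h * t : ℝ) / k) : ℂ) * M (Nat.gcd t (Nat.lcm k m))‖ ≤
      E * classLocalHc α m r k h + (Nat.lcm k m : ℝ) * Bd := by
  rw [sum_class_sub_eq m r k h V P M]
  have h1 : ‖∑ g ∈ (Nat.lcm k m).divisors, classGcdSum m r k h g * (P g - M g)‖ ≤ E * classLocalHc α m r k h := by
    refine (norm_sum_le _ _).trans ?_
    rw [classLocalHc, Finset.mul_sum]
    refine Finset.sum_le_sum fun g hg => ?_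
    rw [norm_mul]
    calc ‖classGcdSum m r k h g‖ * ‖P g - M g‖
        ≤ ‖classGcdSum m r k h g‖ *
            ((g : ℝ) ^ (-α) * ((Nat.lcm k m / g).divisors.card : ℝ) / ((Nat.lcm k m / g).totient : ℝ) * E) :=
          mul_le_mul_of_nonneg_left (hP g hg) (norm_nonneg _)
      _ = E * (‖classGcdSum m r k h g‖ *
            (((g : ℕ) : ℝ) ^ (-α) * ((Nat.lcm k m / g).divisors.card : ℝ) / ((Nat.lcm k m / g).totient : ℝ))) := by
          ring
  have h2 : ‖∑ t ∈ (Finset.range (Nat.lcm k m)).filter (fun t => t ≡ r [MOD m]),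
      (𝐞 ((h * t : ℝ) / k) : ℂ) * (V t - P (Nat.gcd t (Nat.lcm k m)))‖ ≤ (Nat.lcm k m : ℝ) * Bd := by
    refine (norm_sum_le _ _).trans ?_
    have hterm : ∀ t ∈ (Finset.range (Nat.lcm k m)).filter (fun t => t ≡ r [MOD m]),
        ‖(𝐞 ((h * t : ℝ) / k) : ℂ) * (V t - P (Nat.gcd t (Nat.lcm k m)))‖ ≤ Bd := fun t ht => by
      rw [norm_mul, Circle.norm_coe, one_mul]; exact hN t ht
    refine (Finset.sum_le_sum hterm).trans ?_
    rw [Finset.sum_const, nsmul_eq_mul]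
    have hcard : (((Finset.range (Nat.lcm k m)).filter (fun t => t ≡ r [MOD m])).card : ℝ) ≤ Nat.lcm k m := by
      exact_mod_cast (Finset.card_filter_le _ _).trans (Finset.card_range _).le
    exact mul_le_mul_of_nonneg_right hcard hBd
  exact (norm_add_le _ _).trans (add_le_add h1 h2)

/-! ### The pointwise estimate -/

/-- **Class-restricted smooth-weighted friable exponential sums on a major arc, pointwise form.** Let `x ≥ 0`,
`ε₀ > 0`, `C_F ≥ 0`, `η, E ∈ ℝ`, `λ ∈ ℝ`. Assume (hW) AT THIS `x`: for every scaling `1 ≤ e' ≤ E`,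
`‖S_w(λ; x/e') − e'^{−α}𝓜Ŵ_λ(α)‖ ≤ e'^{−α} η𝓜/(1+|λ|)` (`α = α(x,y)`, `𝓜 = x^α ζ(α,y)/√(2πφ₂(α,y))`), and (hF)
`‖∑_{n ∈ S(X,y)} χ(n) W_λ(n/X)‖ ≤ C_F (1+|λ|)³ X^{1/2+ε₀} q^{ε₀}` for `X ≥ 1`, `χ ≠ χ₀ (mod q)`. Then for `1 ≤ e`,
`y`-friable `m, k ≥ 1` with `e · lcm(k, m) ≤ E`, any class `r` and any `h ∈ ℤ` (`L = lcm(k, m)`):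
`‖classArcSum (x/e) y m r k h λ − classLocalFactor α m r k h · e^{−α}𝓜 Ŵ_λ(α)‖`
`≤ e^{−α} (η𝓜/(1+|λ|)) classLocalHc α m r k h + L · C_F (1+|λ|)³ (x/e)^{1/2+ε₀} L^{ε₀}`.
[cite: Harper2016, §2.2 (Major Arc Estimate 2) and §5] -/
theorem classArcSum_estimate_pointwise_of_mul_le {x : ℝ} {y : ℕ} (hx : 0 ≤ x) {η E ε₀ C_F : ℝ} (hε₀ : 0 < ε₀)
    (hC : 0 ≤ C_F) {lam : ℝ}
    (hW : ∀ e' : ℕ, 1 ≤ e' → (e' : ℝ) ≤ E →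
      ‖(∑ n ∈ Nat.smoothNumbersUpTo ⌊x / e'⌋₊ (y + 1), twistWeight lam (n / (x / e'))) -
          ((((e' : ℝ) ^ (-saddlePoint x y) * (x ^ saddlePoint x y * smoothZeta (saddlePoint x y) y /
              Real.sqrt (2 * Real.pi * saddlePhi₂ (saddlePoint x y) y)) : ℝ)) : ℂ) * twistMellin lam (saddlePoint x y)‖ ≤
        (e' : ℝ) ^ (-saddlePoint x y) * (η * (x ^ saddlePoint x y * smoothZeta (saddlePoint x y) y /
          Real.sqrt (2 * Real.pi * saddlePhi₂ (saddlePoint x y) y)) / (1 + |lam|)))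
    (hF : ∀ (q : ℕ) (χ : DirichletCharacter ℂ q), q ≠ 0 → χ ≠ 1 → ∀ (y : ℕ) (X lam : ℝ), 1 ≤ X →
      ‖∑ n ∈ Nat.smoothNumbersUpTo ⌊X⌋₊ (y + 1), χ (n : ZMod q) * twistWeight lam (n / X)‖ ≤
        C_F * (1 + |lam|) ^ 3 * X ^ (1 / 2 + ε₀) * (q : ℝ) ^ ε₀)
    {e m r k : ℕ} (he : 1 ≤ e) (hm : 1 ≤ m) (hmS : m ∈ Nat.smoothNumbers (y + 1)) (hk : 1 ≤ k)
    (hkS : k ∈ Nat.smoothNumbers (y + 1)) (hE : ((e * Nat.lcm k m : ℕ) : ℝ) ≤ E) (h : ℤ) :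
    ‖classArcSum (x / e) y m r k h lam -
        classLocalFactor (saddlePoint x y) m r k h *
          (((((e : ℝ) ^ (-saddlePoint x y) * (x ^ saddlePoint x y * smoothZeta (saddlePoint x y) y /
              Real.sqrt (2 * Real.pi * saddlePhi₂ (saddlePoint x y) y)) : ℝ)) : ℂ) * twistMellin lam (saddlePoint x y))‖ ≤
      (e : ℝ) ^ (-saddlePoint x y) * (η * (x ^ saddlePoint x y * smoothZeta (saddlePoint x y) y /
          Real.sqrt (2 * Real.pi * saddlePhi₂ (saddlePoint x y) y)) / (1 + |lam|)) * classLocalHc (saddlePoint x y) m r k h +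
      (Nat.lcm k m : ℝ) * (C_F * (1 + |lam|) ^ 3 * (x / e) ^ (1 / 2 + ε₀) * ((Nat.lcm k m : ℕ) : ℝ) ^ ε₀) := by
  have he0 : (0 : ℝ) < e := by exact_mod_cast he
  have hX0 : 0 ≤ x / e := by positivity
  have hm0 : m ≠ 0 := by omega
  have hk0 : k ≠ 0 := by omega
  rw [classArcSum_eq_sum_mod (x / e) y hm0 hk0 r h lam]
  unfold classLocalFactor
  set α : ℝ := saddlePoint x y with hα
  have hα0 : 0 ≤ α := saddlePoint_nonneg x y
  set L : ℕ := Nat.lcm k m with hL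
  set M₀ : ℝ := x ^ α * smoothZeta α y / Real.sqrt (2 * Real.pi * saddlePhi₂ α y) with hM₀
  set A : ℝ := (e : ℝ) ^ (-α) * M₀ with hA
  set Eη : ℝ := (e : ℝ) ^ (-α) * (η * M₀ / (1 + |lam|)) with hEη
  set Bd : ℝ := C_F * (1 + |lam|) ^ 3 * (x / e) ^ (1 / 2 + ε₀) * (L : ℝ) ^ ε₀ with hBd
  set Ŵ : ℂ := twistMellin lam α with hŴ
  have hLpos : 0 < L := Nat.lcm_pos (by omega) (by omega)
  have hL0 : L ≠ 0 := hLpos.ne'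
  have hLS : L ∈ Nat.smoothNumbers (y + 1) :=
    Nat.mem_smoothNumbers_of_dvd (Nat.mul_mem_smoothNumbers hkS hmS) (Nat.lcm_dvd_mul k m)
  have hBd0 : 0 ≤ Bd := by positivity
  -- (hW) at the scales `x/(e e')`, `e' ∣ L`
  have hS : ∀ e' : ℕ, e' ∣ L →
      ‖smoothTwistSum (x / e / e') y lam - ((((e' : ℕ) : ℝ) ^ (-α) * A : ℝ) : ℂ) * Ŵ‖ ≤ (e' : ℝ) ^ (-α) * Eη := by
    intro e' he'
    have he'1 : 1 ≤ e' := Nat.pos_of_dvd_of_pos he' hLpos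
    have he'0 : (0 : ℝ) ≤ e' := Nat.cast_nonneg e'
    have he1 : 1 ≤ e * e' := Nat.one_le_iff_ne_zero.mpr (mul_ne_zero (by omega) (by omega))
    have heE : ((e * e' : ℕ) : ℝ) ≤ E := by
      refine le_trans ?_ hE
      exact_mod_cast Nat.mul_le_mul_left e (Nat.le_of_dvd hLpos he')
    have hW1 := hW (e * e') he1 heE
    have hsc : x / e / e' = x / ((e * e' : ℕ) : ℝ) := by push_cast; rw [div_div]
    have hconst : ((e * e' : ℕ) : ℝ) ^ (-α) * M₀ = (e' : ℝ) ^ (-α) * A := by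
      rw [hA]; push_cast
      rw [Real.mul_rpow he0.le he'0]; ring
    have hconst' : ((e * e' : ℕ) : ℝ) ^ (-α) * (η * M₀ / (1 + |lam|)) = (e' : ℝ) ^ (-α) * Eη := by
      rw [hEη]; push_cast
      rw [Real.mul_rpow he0.le he'0]; ring
    rw [hsc, ← hconst, ← hconst']
    simpa [smoothTwistSum] using hW1
  -- (hF) on the sub-scales
  have hF' : ∀ (g' L'' : ℕ) [NeZero L''], 0 < g' → L'' ≤ L → ∀ ψ : DirichletCharacter ℂ L'', ψ ≠ 1 →
      ‖∑ n ∈ Nat.smoothNumbersUpTo ⌊x / e / g'⌋₊ (y + 1), ψ (n : ZMod L'') * twistWeight lam (n / (x / e / g'))‖ ≤ Bd :=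
    fun g' L'' _ hg' hL''L ψ hψ =>
      charSum_bound_subscale_of_nonneg hC hε₀ hF hX0 hg' (NeZero.ne L'') hL''L y lam ψ hψ
  -- the principal part of the fibres with gcd `g`, and its error
  have hP : ∀ g ∈ L.divisors,
      ‖(((L / g).totient : ℂ))⁻¹ * coprimeTwistSum (x / e / g) y (L / g) lam -
          ((((g : ℕ) : ℝ) ^ (-α) * (∏ p ∈ (L / g).primeFactors, (1 - (p : ℝ) ^ (-α))) / ((L / g).totient : ℝ) * A : ℝ) :
            ℂ) * Ŵ‖ ≤
        (g : ℝ) ^ (-α) * ((L / g).divisors.card : ℝ) / ((L / g).totient : ℝ) * Eη := by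
    intro g hg
    have hg0 : 0 < g := Nat.pos_of_mem_divisors hg
    have hgL : g ∣ L := Nat.dvd_of_mem_divisors hg
    have hL'0 : L / g ≠ 0 := (Nat.div_ne_zero_iff_of_dvd hgL).mpr ⟨hL0, hg0.ne'⟩
    have hL'S : L / g ∈ Nat.smoothNumbers (y + 1) := Nat.mem_smoothNumbers_of_dvd hLS (Nat.div_dvd_of_dvd hgL)
    have hS' : ∀ d ∈ (L / g).divisors,
        ‖smoothTwistSum (x / e / g / d) y lam - ((((g * d : ℕ) : ℝ) ^ (-α) * A : ℝ) : ℂ) * Ŵ‖ ≤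
          ((g * d : ℕ) : ℝ) ^ (-α) * Eη := by
      intro d hd
      have h1 := hS (g * d) (Nat.mul_dvd_of_dvd_div hgL (Nat.dvd_of_mem_divisors hd))
      have hsc : x / e / ((g * d : ℕ) : ℝ) = x / e / g / d := by push_cast; ring
      rwa [hsc] at h1
    exact principal_fiber_bound hX0 hg0 hL'0 hL'S hα0 A Eη Ŵ lam hS'
  -- the non-principal part of the fibre `t`
  have hN : ∀ t ∈ (Finset.range L).filter (fun t => t ≡ r [MOD m]),
      ‖(∑ n ∈ (Nat.smoothNumbersUpTo ⌊x / e⌋₊ (y + 1)).filter (fun n => n % L = t), twistWeight lam (n / (x / e))) -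
          (((L / Nat.gcd t L).totient : ℂ))⁻¹ * coprimeTwistSum (x / e / Nat.gcd t L) y (L / Nat.gcd t L) lam‖ ≤ Bd := by
    intro t ht
    have htL : t < L := Finset.mem_range.mp (Finset.mem_filter.mp ht).1
    exact fiber_sub_principal_bound hX0 hL0 htL hLS lam hBd0 hF'
  -- the main term as a sum over the classes with the same phases
  have hfac : (∑ t ∈ (Finset.range L).filter (fun t => t ≡ r [MOD m]), (𝐞 ((h * t : ℝ) / k) : ℂ) *
      ((((Nat.gcd t L : ℕ) : ℝ) ^ (-α) * (∏ p ∈ (L / Nat.gcd t L).primeFactors, (1 - (p : ℝ) ^ (-α))) /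
        ((L / Nat.gcd t L).totient : ℝ) : ℝ) : ℂ)) * (((A : ℝ) : ℂ) * Ŵ) =
      ∑ t ∈ (Finset.range L).filter (fun t => t ≡ r [MOD m]), (𝐞 ((h * t : ℝ) / k) : ℂ) *
        (((((Nat.gcd t L : ℕ) : ℝ) ^ (-α) * (∏ p ∈ (L / Nat.gcd t L).primeFactors, (1 - (p : ℝ) ^ (-α))) /
          ((L / Nat.gcd t L).totient : ℝ) * A : ℝ) : ℂ) * Ŵ) := by
    rw [Finset.sum_mul]
    refine Finset.sum_congr rfl fun t _ => ?_
    push_cast; ring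
  rw [hfac]
  exact norm_sum_class_sub_le h α Eη hBd0
    (fun t => ∑ n ∈ (Nat.smoothNumbersUpTo ⌊x / e⌋₊ (y + 1)).filter (fun n => n % L = t), twistWeight lam (n / (x / e)))
    (fun g => (((L / g).totient : ℂ))⁻¹ * coprimeTwistSum (x / e / g) y (L / g) lam)
    (fun g => ((((g : ℕ) : ℝ) ^ (-α) * (∏ p ∈ (L / g).primeFactors, (1 - (p : ℝ) ^ (-α))) /
      ((L / g).totient : ℝ) * A : ℝ) : ℂ) * Ŵ) hP hN

/-- **Class-restricted smooth-weighted friable exponential sums on a major arc, pointwise form** (the statement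
with the scaling bound `e · lcm(k, m)² ≤ E` and the window `|λ| ≤ Λ`): with the notation and the inputs (hW) (now for
all `|λ| ≤ Λ`), (hF) of `classArcSum_estimate_pointwise_of_mul_le`, for `x ≥ 1`, `1 ≤ e`, `y`-friable `m, k ≥ 1`,
`e · lcm(k,m)² ≤ E`, any `r`, `h` and `|λ| ≤ Λ`:
`‖classArcSum (x/e) y m r k h λ − classLocalFactor α m r k h · e^{−α}𝓜 Ŵ_λ(α)‖`
`≤ e^{−α} (η𝓜/(1+|λ|)) classLocalHc α m r k h + L · C_F (1+|λ|)³ (x/e)^{1/2+ε₀} L^{ε₀}`.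
[cite: Harper2016, §2.2 (Major Arc Estimate 2) and §5] -/
theorem classArcSum_estimate_pointwise {x : ℝ} {y : ℕ} (hx : 1 ≤ x) {Λ η E ε₀ C_F : ℝ} (hε₀ : 0 < ε₀)
    (hC : 0 ≤ C_F)
    (hW : ∀ e' : ℕ, 1 ≤ e' → (e' : ℝ) ≤ E → ∀ lam : ℝ, |lam| ≤ Λ →
      ‖(∑ n ∈ Nat.smoothNumbersUpTo ⌊x / e'⌋₊ (y + 1), twistWeight lam (n / (x / e'))) -
          ((((e' : ℝ) ^ (-saddlePoint x y) * (x ^ saddlePoint x y * smoothZeta (saddlePoint x y) y /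
              Real.sqrt (2 * Real.pi * saddlePhi₂ (saddlePoint x y) y)) : ℝ)) : ℂ) * twistMellin lam (saddlePoint x y)‖ ≤
        (e' : ℝ) ^ (-saddlePoint x y) * (η * (x ^ saddlePoint x y * smoothZeta (saddlePoint x y) y /
          Real.sqrt (2 * Real.pi * saddlePhi₂ (saddlePoint x y) y)) / (1 + |lam|)))
    (hF : ∀ (q : ℕ) (χ : DirichletCharacter ℂ q), q ≠ 0 → χ ≠ 1 → ∀ (y : ℕ) (X lam : ℝ), 1 ≤ X →
      ‖∑ n ∈ Nat.smoothNumbersUpTo ⌊X⌋₊ (y + 1), χ (n : ZMod q) * twistWeight lam (n / X)‖ ≤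
        C_F * (1 + |lam|) ^ 3 * X ^ (1 / 2 + ε₀) * (q : ℝ) ^ ε₀)
    {e m r k : ℕ} (he : 1 ≤ e) (hm : 1 ≤ m) (hmS : m ∈ Nat.smoothNumbers (y + 1)) (hk : 1 ≤ k)
    (hkS : k ∈ Nat.smoothNumbers (y + 1)) (hE : ((e * (Nat.lcm k m) ^ 2 : ℕ) : ℝ) ≤ E) (h : ℤ) {lam : ℝ}
    (hlam : |lam| ≤ Λ) :
    ‖classArcSum (x / e) y m r k h lam -
        classLocalFactor (saddlePoint x y) m r k h *
          (((((e : ℝ) ^ (-saddlePoint x y) * (x ^ saddlePoint x y * smoothZeta (saddlePoint x y) y /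
              Real.sqrt (2 * Real.pi * saddlePhi₂ (saddlePoint x y) y)) : ℝ)) : ℂ) * twistMellin lam (saddlePoint x y))‖ ≤
      (e : ℝ) ^ (-saddlePoint x y) * (η * (x ^ saddlePoint x y * smoothZeta (saddlePoint x y) y /
          Real.sqrt (2 * Real.pi * saddlePhi₂ (saddlePoint x y) y)) / (1 + |lam|)) * classLocalHc (saddlePoint x y) m r k h +
      (Nat.lcm k m : ℝ) * (C_F * (1 + |lam|) ^ 3 * (x / e) ^ (1 / 2 + ε₀) * ((Nat.lcm k m : ℕ) : ℝ) ^ ε₀) := by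
  have hL1 : 1 ≤ Nat.lcm k m := Nat.lcm_pos (by omega) (by omega)
  have hE' : ((e * Nat.lcm k m : ℕ) : ℝ) ≤ E :=
    le_trans (by exact_mod_cast Nat.mul_le_mul_left e (le_self_pow hL1 two_ne_zero)) hE
  exact classArcSum_estimate_pointwise_of_mul_le (zero_le_one.trans hx) hε₀ hC (fun e' he1 heE => hW e' he1 heE lam hlam)
    hF he hm hmS hk hkS hE' h

end SmoothArcs

end Literature.NumberTheory.Sieve

end
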